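import Summits.BirchSwinnertonDyer.BirchSwinnertonDyer.Theorems.KatoDescentPotSupersingularKatoSigmaTransvectionBasis
import Literature.NumberTheory.EllipticCurves.TateModuleTransvectionCriterionProofs
import Literature.NumberTheory.EllipticCurves.NonEisensteinPrimeOfSurjective
import HarnessLib

/-!
# Kato's hypothesis of Thm. 13.4 (3) for `T = T_pE` is (12.5.2) — also at `p = 3`

Route-free Theorems file of cell `bsd-potss` (namespace `…Theorems.KatoSigma`); THEOREMS ONLY (no
definition, no named fact; imports Literature + part 1). Part 2 of 2 (part 1:
`Theorems/KatoDescentPotSupersingularKatoSigmaTransvectionBasis.lean`).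
Cell `bsd-potss`, seat `bsd-potss-k9-c4` g13 (prover; item stmt-BirchSwinnertonDyer-19197
`WildUpperDefectRankZero` / node 19189 `WildUpperNonsurjTower` of route `KatoDescentPotSupersingular`,
rung K9 = the wild prime `3` of the additive potentially supersingular class O6). HONEST FRAMING:
a NO-GO inside Kato's printed theorem; it books nothing and proves BSD for no curve.

K. Kato, *Astérisque* 295 (2004), Thm. 13.4 (p. 226) — the Euler-system bound behind Thm. 12.5 (4),
Thm. 14.5 (3) (rank-`0` upper bound `ord_p #Ш ≤ ord_p(L(E,1)/Ω)` at a potentially good prime) and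
Thm. 17.4 (3) — has an integral clause (3) whose hypothesis is not (12.5.2) ("the image of
`Gal(ℚ̄/ℚ(ζ_{p^∞}))` contains `SL₂(ℤ_p)`", p. 222) but «there exists `σ ∈ Gal(ℚ̄/ℚ(ζ_{p^∞}))` with
`Coker(1 − σ : T → T)` free of rank `1`, and `T/𝔪T` irreducible, `p ≠ 2`» (= hypothesis (im) of
Burungale–Castella–Skinner 2025; tree: `Kato2004.fineSelmer_eulerSystemBound` clause (3),
`Kato2004.exists_quotient_range_sub_one_equiv_of_imageContainsSL2` for (12.5.2) ⟹ (im)); and the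
proof of 12.5 (4) (13.14, p. 234) uses (12.5.2) only through Remark 12.8 (needs `E[p]` irreducible
only) and Thm. 13.4 (3). On the rows of the BSD rank-≤1 census where (12.5.2) FAILS at `p = 3` with
`E[3]` IRREDUCIBLE — node `WildUpperNonsurjTower` of cell `bsd-potss`: Elkies' `9`-deficient curves
(`ρ̄_{E,3}` onto, `ρ̄_{E,9}` not; arXiv:math/0612734) and the normaliser-of-Cartan images — could the
weaker hypothesis hold? For NON-surjective `ρ̄_{E,p}` the answer NO is the tree theorem
`WeierstrassCurve.isEmpty_quotient_range_galoisRepTate_sub_one_equiv` (Serre's Prop. 15 backwards;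
BCS Rem. 1.1.3 (iii): irr ∧ (im) ⟹ surj(`p`)), which for `p ≥ 5` gives (12.5.2) by Serre's lifting
lemma. At `p = 3` surj(3) does NOT lift (`SL₂(ℤ/9) → SL₂(𝔽₃)` splits; Elkies 2006) and the
mod-`3` shadow of a Kato `σ` on a `9`-deficient curve is an honest transvection of `GL₂(𝔽₃)`.
This file closes the gap:

* `KatoSigma.forall_hasSurjectiveModNGaloisRep_three_pow_of_quotient_range_sub_one_equiv`:
  **`E[3]` irreducible and a Kato `σ` at `3` ⟹ `ρ̄_{E,3^n}` onto for every `n`** (`…nine_of…`: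
  `ρ̄_{E,9}` onto; `KatoSigma.imageContainsSL2_three_of_…`: (12.5.2));
* `KatoSigma.isEmpty_quotient_range_galoisRepTate_sub_one_equiv_of_not_forall_three_pow`
  (`…_of_not_nine`): the NO-GO — `E[3]` irreducible and `3`-adic tower not onto ⟹ NO
  `σ ∈ Gal(ℚ̄/ℚ(ζ_{3^∞}))` has `T_3E/(σ − 1) ≃ ℤ_3`: Kato's clause 13.4 (3) is unsatisfiable on
  EVERY row of `WildUpperNonsurjTower`, the `9`-deficient ones included;
* `KatoSigma.imageContainsSL2_iff_irreducible_and_exists_quotient_equiv` (every odd `p`):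
  **(12.5.2) ⟺ (`E[p]` irreducible ∧ ∃ Kato `σ`)** for the Tate module of an elliptic curve over `ℚ`.

Proof at `p = 3` (`GL₂(ℤ/9)`, in the first-order-kernel calculus of `Condition1252.lean`): surj(3)
by the mod-`p` theorem; in the adapted basis of part 1 `[ρ(σ³)] = 1 + 3E`, `E = (0 1; 0 0)`, a
TRACELESS first-order element (alone: `im ρ̄_9 ⊇ 1 + 3·sl₂(𝔽₃)` only — Elkies' index-`27` group);
the determinant supplies the scalar: `g` with `χ_3(g) = 4`, and in `SL₂(𝔽₃) = Q₈ ⋊ ⟨1 + Ē⟩` some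
`ḡ(1 + Ē)^j` is `±1` or traceless (finite check), so `[ρ((gσ^j)⁴)] = 1 + 3M` with `det = 256`,
`tr M = 85 − 3 det M ∈ ℤ_3ˣ`; `M` or `M + E` is a unit-trace non-scalar witness for
`forall_hasSurjectiveModNGaloisRep_of_firstOrderWitness` (Serre IV-23 at level `9`).

presearch (2026-08-27; corpus fts+vec, galaxy): «Euler system hypothesis `T/(σ−1)T` free of rank
one; surjective mod 3 not mod 9» → generic hits only (Rubin in LNM 1716, Delbourgo 2008); galaxy
`"surjective mod 3 but not mod 9|not surjective mod 9"` → 0. Nearest print: BCS 2025 Rem. 1.1.3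
(iii) (mod `p`), Elkies 2006, Serre 1968 IV-23. The level-`9` statement appears unrecorded.

References: [Kato2004Asterisque] K. Kato, Astérisque 295 (2004), (12.5.2) p. 222, Rem. 12.8 p. 223,
Thm. 13.4 (3) p. 226, 13.14 p. 234, Thm. 14.5 (3) p. 236, Thm. 17.4 (3) p. 273 ·
[BurungaleCastellaSkinner2025] IMRN 2025 = arXiv:2405.00270v2, (im), Rem. 1.1.3 (iii) ·
[SerreAbelianLadic1968] Ch. IV §3.4 Lemma 3 (IV-23) · [Serre1972] §2.4 Prop. 15 · [Elkies2006]
arXiv:math/0612734, Introduction and §1.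
-/


set_option autoImplicit false
-- the Theorems directory repeats the summit name (sibling precedent `KatoDescentPotSupersingularAssembly.lean`)
set_option linter.dupNamespace false

noncomputable section

open scoped Classical
open Field

namespace Summit.BirchSwinnertonDyer.BirchSwinnertonDyer.Theorems.KatoSigma

open Literature.NumberTheory.EllipticCurves Literature.NumberTheory.EllipticCurves.Kato2004
  Literature.NumberTheory.GaloisRepresentations WeierstrassCurve

/-! ### The prime `3`: a Kato `σ` forces `ρ̄_{E,9}` onto -/

section Three

/-- **At `p = 3`: a Kato `σ` and irreducible `E[3]` force the whole `3`-adic tower onto.**  Let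
`E = W/ℚ` be an elliptic curve with `E[3]` irreducible, and suppose some `σ ∈ Gal(ℚ̄/ℚ(ζ_{3^∞}))` has
`T_3E/(ρ(σ) − 1)T_3E ≃ ℤ_3` (hypothesis of Kato's Thm. 13.4 (3) for `T = T_3E`; BCS 2025 (im)).
Then `ρ̄_{E,3^n}` is onto for every `n` — in particular `ρ̄_{E,9}`, which surj(3) alone does NOT
give (Elkies 2006). Proof in the module docstring (surj(3); `ρ(σ³) = 1 + 3E`; the determinant-`4`
element; Serre IV-23 at level `9` via `forall_hasSurjectiveModNGaloisRep_of_firstOrderWitness`).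
[cite: Kato2004Asterisque, Thm. 13.4 (3) (p. 226) and (12.5.2) in Thm. 12.5 (4) (p. 222)]
[cite: SerreAbelianLadic1968, Ch. IV §3.4, Lemma 3 (IV-23)] [cite: Elkies2006, Introduction (p. 1) and §1] -/
theorem forall_hasSurjectiveModNGaloisRep_three_pow_of_quotient_range_sub_one_equiv
    (W : WeierstrassCurve ℚ) [W.IsElliptic] [Fact (Nat.Prime 3)]
    (hirr : W.HasIrreducibleModPGaloisRep 3) (σ : absoluteGaloisGroup ℚ)
    (hσ : ∀ (n : ℕ) (t : AlgebraicClosure ℚ), t ^ 3 ^ n = 1 → σ • t = t)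
    (Ψ : ((W.tateModule 3) ⧸ LinearMap.range (W.galoisRepTate 3 σ - 1)) ≃ₗ[ℤ_[3]] ℤ_[3])
    (n : ℕ) : W.HasSurjectiveModNGaloisRep ((3 : ℕ) ^ n : ℕ) := by
  -- (1) `ρ̄_{E,3}` is onto (the mod-`p` no-go, contrapositive)
  have h1 : W.HasSurjectiveModNGaloisRep (3 : ℕ) := by
    by_contra hns
    exact (isEmpty_quotient_range_galoisRepTate_sub_one_equiv W 3 hirr hns σ hσ).false Ψ
  -- (2) an adapted basis: `[ρ σ]_b = 1 + E`
  obtain ⟨b, hU⟩ := exists_basis_toMatrix_galoisRepTate_eq_transvection W 3 σ hσ Ψ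
  set ρ := W.galoisRepTate 3 with hρ
  set E : Matrix (Fin 2) (Fin 2) ℤ_[3] := !![0, 1; 0, 0] with hE
  have hU' : LinearMap.toMatrix b b (ρ σ) = 1 + E := by
    rw [hU, hE]
    ext i j
    fin_cases i <;> fin_cases j <;> simp
  have hpow : ∀ k : ℕ, LinearMap.toMatrix b b (ρ (σ ^ k)) = (1 + E) ^ k := by
    intro k
    induction k with
    | zero => rw [pow_zero, pow_zero, map_one, LinearMap.toMatrix_one]
    | succ k ih => rw [pow_succ, map_mul, LinearMap.toMatrix_mul, ih, hU', ← pow_succ]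
  -- (3) `E` is a first-order kernel element: `ρ(σ³) ↦ 1 + 3E`
  have hE1 : ∃ (τ : absoluteGaloisGroup ℚ) (V : Matrix (Fin 2) (Fin 2) ℤ_[3]),
      LinearMap.toMatrix b b (ρ τ) = 1 + ((3 : ℕ) : ℤ_[3]) • E + (((3 : ℕ) : ℤ_[3]) ^ 2) • V := by
    refine ⟨σ ^ 3, 0, ?_⟩
    rw [hpow 3, hE, one_add_matE_pow, smul_zero, add_zero]
  -- (4) an element of determinant `4`
  have hirrQ : ∀ m : ℕ, 0 < m → Irreducible (Polynomial.cyclotomic m ℚ) :=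
    fun m hm => Polynomial.cyclotomic.irreducible_rat hm
  have h4 : IsUnit (4 : ℤ_[3]) := by
    have := isUnit_one_add_three_mul 1
    norm_num at this
    exact this
  obtain ⟨g, hg⟩ := GaloisRep.cyclotomicCharacter_surjective ℚ 3 hirrQ h4.unit
  have hdetg : LinearMap.det (ρ g) = 4 := by
    rw [hρ, det_galoisRepTate_eq_cyclotomicCharacter W 3 (by norm_num)
      (fun m => exists_weilPairing_holds W _) g, hg, IsUnit.unit_spec]
  set G := LinearMap.toMatrix b b (ρ g) with hG
  have hdetG : G.det = 4 := by rw [hG, LinearMap.det_toMatrix, hdetg]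
  -- reductions modulo `3`
  set red := (PadicInt.toZMod (p := 3)).mapMatrix (m := Fin 2) with hred
  have hredE : red E = !![0, 1; 0, 0] := by
    rw [hE]
    ext i j
    fin_cases i <;> fin_cases j <;> simp [hred]
  have hdetGb : (red G).det = 1 := by
    rw [hred, ← RingHom.map_det, hdetG, map_ofNat]
    rfl
  obtain ⟨j, hj⟩ := zmod3_sl2_cases ((red G) 0 0) ((red G) 0 1) ((red G) 1 0) ((red G) 1 1)
    (by rw [← hdetGb, Matrix.det_fin_two])
  set m : ℕ := j.val with hm
  have hmj : ((m : ℕ) : ZMod 3) = j := ZMod.natCast_zmod_val j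
  -- `x = g σ^m`, its matrix `X = G (1+E)^m`, and `X̄⁴ = 1`
  set x : absoluteGaloisGroup ℚ := g * σ ^ m with hx
  have hX : LinearMap.toMatrix b b (ρ x) = G * (1 + E) ^ m := by
    rw [hx, map_mul, LinearMap.toMatrix_mul, hpow]
  have hXb : red (G * (1 + E) ^ m) = red G + j • (red G * !![0, 1; 0, 0]) := by
    rw [map_mul, map_pow, map_add, map_one, hredE, one_add_matE_pow, hmj, mul_add, mul_one,
      Matrix.mul_smul]
  have hXb4 : (red (G * (1 + E) ^ m)) ^ 4 = 1 := by
    rw [hXb]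
    rcases hj with ⟨hc, htr⟩ | ⟨hc, hd, ha, hb⟩
    · apply mat_pow_four_of_trace_zero_of_det_one
      · rw [Matrix.trace_add, Matrix.trace_smul, Matrix.trace_fin_two, Matrix.trace_fin_two]
        simp [Matrix.mul_apply, Fin.sum_univ_two]
        linear_combination htr
      · have hdet1 : (red G + j • (red G * !![0, 1; 0, 0])).det = (red G).det := by
          simp [Matrix.det_fin_two, Matrix.mul_apply, Fin.sum_univ_two]
          ring
        rw [hdet1, hdetGb]
    · have hscal : red G + j • (red G * !![0, 1; 0, 0]) = (red G 0 0) • (1 : Matrix (Fin 2) (Fin 2) (ZMod 3)) := by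
        ext i k
        fin_cases i <;> fin_cases k <;>
          simp [Matrix.mul_apply, Fin.sum_univ_two, hc, hd]
        linear_combination hb
      have ha4 : red G 0 0 ^ 4 = 1 := by
        calc red G 0 0 ^ 4 = (red G 0 0 * red G 0 0) * (red G 0 0 * red G 0 0) := by ring
          _ = 1 := by rw [ha, one_mul]
      rw [hscal, smul_pow, one_pow, ha4, one_smul]
  -- lift: `[ρ(x⁴)]_b = 1 + 3 M`
  set K := LinearMap.toMatrix b b (ρ (x ^ 4)) with hK
  have hKX : K = (G * (1 + E) ^ m) ^ 4 := by
    rw [hK, map_pow, toMatrix_pow_eq, hX]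
  have hredK : red (K - 1) = 0 := by
    rw [map_sub, hKX, map_pow, hXb4, map_one, sub_self]
  have hKij : ∀ i k, ∃ y : ℤ_[3], (K - 1) i k = 3 * y := by
    intro i k
    apply exists_eq_three_mul_of_toZMod_eq_zero
    have := congrFun (congrFun hredK i) k
    simpa [hred] using this
  choose Mf hMf using hKij
  set M : Matrix (Fin 2) (Fin 2) ℤ_[3] := Matrix.of fun i k => Mf i k with hMdef
  have hKM : K = 1 + ((3 : ℕ) : ℤ_[3]) • M := by
    have h0 : K - 1 = ((3 : ℕ) : ℤ_[3]) • M := by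
      ext i k
      rw [hMf i k, Matrix.smul_apply, hMdef, Matrix.of_apply, smul_eq_mul, Nat.cast_ofNat]
    rw [← h0, add_sub_cancel]
  have hM1 : ∃ (τ : absoluteGaloisGroup ℚ) (V : Matrix (Fin 2) (Fin 2) ℤ_[3]),
      LinearMap.toMatrix b b (ρ τ) = 1 + ((3 : ℕ) : ℤ_[3]) • M + (((3 : ℕ) : ℤ_[3]) ^ 2) • V :=
    ⟨x ^ 4, 0, by rw [← hK, hKM, smul_zero, add_zero]⟩
  -- the trace of `M` is a unit: `det K = 4⁴ = 256`
  have hdet1E : ((1 : Matrix (Fin 2) (Fin 2) ℤ_[3]) + E).det = 1 := by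
    rw [hE]
    simp [Matrix.det_fin_two]
  have hdetK : K.det = 256 := by
    rw [hKX, Matrix.det_pow, Matrix.det_mul, Matrix.det_pow, hdetG, hdet1E]
    norm_num
  have htrM : IsUnit M.trace := by
    have h3 : (1 + ((3 : ℕ) : ℤ_[3]) • M).det = 256 := by rw [← hKM, hdetK]
    rw [mat_det_one_add_smul, Nat.cast_ofNat] at h3
    have h5 : M.trace = 1 + 3 * (28 - M.det) := by
      have h6 : (3 : ℤ_[3]) * (M.trace - (1 + 3 * (28 - M.det))) = 0 := by
        linear_combination h3
      have h3ne : (3 : ℤ_[3]) ≠ 0 := by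
        haveI : Fact (Nat.Prime 3) := ⟨Nat.prime_three⟩
        exact_mod_cast (Fact.out : Nat.Prime 3).ne_zero
      exact sub_eq_zero.mp ((mul_eq_zero.mp h6).resolve_left h3ne)
    rw [h5]
    exact isUnit_one_add_three_mul _
  -- the witness: `M` itself if non-scalar modulo `3`, else `M + E`
  by_cases hns : IsUnit (M 1 0) ∨ IsUnit (M 0 1) ∨ IsUnit (M 0 0 - M 1 1)
  · exact forall_hasSurjectiveModNGaloisRep_of_firstOrderWitness (by decide) h1 b M hM1 hns htrM n
  · have hM01 : ¬ IsUnit (M 0 1) := fun h => hns (Or.inr (Or.inl h))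
    obtain ⟨y, hy⟩ := exists_eq_three_mul_of_not_isUnit hM01
    refine forall_hasSurjectiveModNGaloisRep_of_firstOrderWitness (by decide) h1 b (M + E) ?_ ?_ ?_ n
    · refine ⟨x ^ 4 * σ ^ 3, M * E, ?_⟩
      rw [map_mul, LinearMap.toMatrix_mul, ← hK, hKM, hpow 3, hE, one_add_matE_pow,
        mat_one_add_smul_mul_one_add_smul]
    · right; left
      rw [Matrix.add_apply, hy, hE]
      simp
      have := isUnit_one_add_three_mul y
      rwa [add_comm] at this
    · have htr0 : (M + E).trace = M.trace := by
        rw [Matrix.trace_add, hE, Matrix.trace_fin_two, Matrix.trace_fin_two]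
        simp
      rw [htr0]
      exact htrM

/-- **`ρ̄_{E,9}` onto from a Kato `σ` at `3`** (`E[3]` irreducible). [cite: Kato2004Asterisque, Thm. 13.4 (3) (p. 226)]
[cite: Elkies2006, Introduction (p. 1) and §1] -/
theorem hasSurjectiveModNGaloisRep_nine_of_quotient_range_sub_one_equiv
    (W : WeierstrassCurve ℚ) [W.IsElliptic] [Fact (Nat.Prime 3)]
    (hirr : W.HasIrreducibleModPGaloisRep 3) (σ : absoluteGaloisGroup ℚ)
    (hσ : ∀ (n : ℕ) (t : AlgebraicClosure ℚ), t ^ 3 ^ n = 1 → σ • t = t)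
    (Ψ : ((W.tateModule 3) ⧸ LinearMap.range (W.galoisRepTate 3 σ - 1)) ≃ₗ[ℤ_[3]] ℤ_[3]) :
    W.HasSurjectiveModNGaloisRep 9 := by
  have h := forall_hasSurjectiveModNGaloisRep_three_pow_of_quotient_range_sub_one_equiv W hirr σ hσ Ψ 2
  rwa [show (((3 : ℕ) ^ 2 : ℕ) : ℤ) = 9 by norm_num] at h

/-- **NO-GO: Kato 13.4 (3) / (im) is unsatisfiable on the irreducible, tower-non-onto rows at `3`.**
For `E = W/ℚ` with `E[3]` irreducible whose `3`-adic tower `ρ̄_{E,3^n}` is NOT onto for some `n`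
(the `9`-deficient curves of Elkies and the normaliser-of-Cartan images — the node
`WildUpperNonsurjTower` of cell `bsd-potss`), NO `σ ∈ Gal(ℚ̄/ℚ(ζ_{3^∞}))` has
`T_3E/(ρ(σ) − 1)T_3E ≃ ℤ_3`: on these rows Kato's integral clause 13.4 (3) itself, not only its
sufficient condition (12.5.2), has no witness. [cite: Kato2004Asterisque, Thm. 13.4 (3) (p. 226) and (12.5.2) in Thm. 12.5 (4) (p. 222)]
[cite: BurungaleCastellaSkinner2025, hypothesis (im) and Rem. 1.1.3 (iii)] [cite: Elkies2006, Introduction (p. 1) and §1] -/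
theorem isEmpty_quotient_range_galoisRepTate_sub_one_equiv_of_not_forall_three_pow
    (W : WeierstrassCurve ℚ) [W.IsElliptic] [Fact (Nat.Prime 3)]
    (hirr : W.HasIrreducibleModPGaloisRep 3)
    (hns : ¬ ∀ n : ℕ, W.HasSurjectiveModNGaloisRep ((3 : ℕ) ^ n : ℕ)) (σ : absoluteGaloisGroup ℚ)
    (hσ : ∀ (n : ℕ) (t : AlgebraicClosure ℚ), t ^ 3 ^ n = 1 → σ • t = t) :
    IsEmpty (((W.tateModule 3) ⧸ LinearMap.range (W.galoisRepTate 3 σ - 1)) ≃ₗ[ℤ_[3]] ℤ_[3]) :=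
  ⟨fun Ψ => hns
    (forall_hasSurjectiveModNGaloisRep_three_pow_of_quotient_range_sub_one_equiv W hirr σ hσ Ψ)⟩

/-- The same no-go with the hypothesis «`ρ̄_{E,9}` not onto». [cite: Kato2004Asterisque, Thm. 13.4 (3) (p. 226)]
[cite: Elkies2006, Introduction (p. 1) and §1] -/
theorem isEmpty_quotient_range_galoisRepTate_sub_one_equiv_of_not_nine
    (W : WeierstrassCurve ℚ) [W.IsElliptic] [Fact (Nat.Prime 3)]
    (hirr : W.HasIrreducibleModPGaloisRep 3) (h9 : ¬ W.HasSurjectiveModNGaloisRep 9)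
    (σ : absoluteGaloisGroup ℚ)
    (hσ : ∀ (n : ℕ) (t : AlgebraicClosure ℚ), t ^ 3 ^ n = 1 → σ • t = t) :
    IsEmpty (((W.tateModule 3) ⧸ LinearMap.range (W.galoisRepTate 3 σ - 1)) ≃ₗ[ℤ_[3]] ℤ_[3]) :=
  ⟨fun Ψ => h9 (hasSurjectiveModNGaloisRep_nine_of_quotient_range_sub_one_equiv W hirr σ hσ Ψ)⟩

end Three


/-- **Kato's (12.5.2) at `p = 3` from ONE Kato `σ`** (`E[3]` irreducible): the hypothesis of
Thm. 13.4 (3) for `T = T_3E` implies — hence, with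
`exists_quotient_range_sub_one_equiv_of_imageContainsSL2`, is equivalent to — (12.5.2).
[cite: Kato2004Asterisque, Thm. 13.4 (3) (p. 226) and (12.5.2) in Thm. 12.5 (4) (p. 222)] -/
theorem imageContainsSL2_three_of_quotient_range_sub_one_equiv (W : WeierstrassCurve ℚ)
    [W.IsElliptic] [Fact (Nat.Prime 3)] (hirr : W.HasIrreducibleModPGaloisRep 3)
    (σ : absoluteGaloisGroup ℚ)
    (hσ : ∀ (n : ℕ) (t : AlgebraicClosure ℚ), t ^ 3 ^ n = 1 → σ • t = t)
    (Ψ : ((W.tateModule 3) ⧸ LinearMap.range (W.galoisRepTate 3 σ - 1)) ≃ₗ[ℤ_[3]] ℤ_[3]) :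
    ImageContainsSL2 W 3 :=
  imageContainsSL2_of_forall_hasSurjectiveModNGaloisRep W 3
    (forall_hasSurjectiveModNGaloisRep_three_pow_of_quotient_range_sub_one_equiv W hirr σ hσ Ψ)

/-- **For every odd prime `p`: Kato's (12.5.2) for `T_pE` ⟺ (`E[p]` irreducible ∧ some
`σ ∈ Gal(ℚ̄/ℚ(ζ_{p^∞}))` has `T_pE/(ρ(σ) − 1)T_pE ≃ ℤ_p`)** — (12.5.2) ⟺ the hypothesis of Kato's
Thm. 13.4 (3) for the Tate module of an elliptic curve over `ℚ` (`⇒`: surj(`p`) ⟹ irreducible, and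
`σ ↦ (1 1; 0 1)`; `⇐`: `p ≥ 5` by the mod-`p` no-go and Serre's lifting lemma, `p = 3` by the
level-`9` theorem above). [cite: Kato2004Asterisque, Thm. 13.4 (3) (p. 226) and (12.5.2) in Thm. 12.5 (4) (p. 222)]
[cite: SerreAbelianLadic1968, Ch. IV §3.4, Lemma 3 (IV-23)] [cite: BurungaleCastellaSkinner2025, hypothesis (im) and Rem. 1.1.3 (iii)] -/
theorem imageContainsSL2_iff_irreducible_and_exists_quotient_equiv (W : WeierstrassCurve ℚ)
    [W.IsElliptic] (p : ℕ) [Fact p.Prime] (hp2 : p ≠ 2) :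
    ImageContainsSL2 W p ↔
      (W.HasIrreducibleModPGaloisRep p ∧ ∃ σ : absoluteGaloisGroup ℚ,
        (∀ (n : ℕ) (t : AlgebraicClosure ℚ), t ^ p ^ n = 1 → σ • t = t) ∧
          Nonempty (((W.tateModule p) ⧸ LinearMap.range (W.galoisRepTate p σ - 1)) ≃ₗ[ℤ_[p]]
            ℤ_[p])) := by
  have hp : p.Prime := Fact.out
  constructor
  · intro h
    haveI : NeZero (p : ℚ) := ⟨Nat.cast_ne_zero.mpr hp.ne_zero⟩
    refine ⟨hasIrreducibleModPGaloisRep_of_hasSurjectiveModNGaloisRep W p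
      (hasSurjectiveModNGaloisRep_of_imageContainsSL2 W p h), ?_⟩
    obtain ⟨σ, hσ, hne⟩ := exists_quotient_range_sub_one_equiv_of_imageContainsSL2 W p h
    exact ⟨σ, hσ, hne⟩
  · rintro ⟨hirr, σ, hσ, ⟨Ψ⟩⟩
    by_cases h3 : p = 3
    · subst h3
      exact imageContainsSL2_three_of_quotient_range_sub_one_equiv W hirr σ hσ Ψ
    · have h5 : 5 ≤ p := hp.five_le_of_ne_two_of_ne_three hp2 h3
      have h1 : W.HasSurjectiveModNGaloisRep p := by
        by_contra hns
        exact (WeierstrassCurve.isEmpty_quotient_range_galoisRepTate_sub_one_equiv W p hirr hns σ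
          hσ).false Ψ
      exact imageContainsSL2_of_hasSurjectiveModNGaloisRep W p h5 h1

end Summit.BirchSwinnertonDyer.BirchSwinnertonDyer.Theorems.KatoSigma

end
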